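import Literature.Probability.FitznerVanDerHofstad2017.BlockSummation
import HarnessLib

/-!
# [FvdH17] §6.2.1 (6.48)–(6.49): the recursion `P^{(N)}` as a CLOSED SUM over the chain of levels — Fin-vector tools

Source: R. Fitzner, R. van der Hofstad, *Mean-field behavior for nearest-neighbor percolation in `d > 10`*,
Electron. J. Probab. **22** (2017) no. 43 [FvdH17]; extended version arXiv:1506.07977v2, §6.2.1 (6.48)–(6.49)
(p. 65): "for `N ≥ 1`, we recursively define `P^{(N),b}(u_N,w_N) = Σ_{u_{N-1},w_{N-1}} Σ_κ Σ_{a} P^{(N-1),a}(u_{N-1},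
w_{N-1}) B^{κ,a,b}(u_{N-1},w_{N-1},w_N,u_N)`", and the proof of Lemma 6.1 (pp. 66–67): "To prove the bounds for
all `N` we use induction on `N`" — the bounding diagram of a chain of levels is
`P^{S,a_0}(u_0,w_0) ∏_{i<L} B^{κ_i,a_i,a_{i+1}}(u_i,w_i,w_{i+1},u_{i+1})` summed over all intermediate data.

This module is pure `[0,∞]` bookkeeping next to `BlockSummation.recP` (abstract sites `G`, classes `ι`, directions
`K`), written for the regrouping step of the `N ≥ 2` bound (the "X2-cls" leaf of the package).  It proves that the
recursion (6.49) IS the closed chain sum (`recP_eq_tsum_chainW`, level data bundled as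
`δ_i = (u_i, w_i, κ_i, a_i) : G × G × K × ι`, `i < L`, completed by the exit data `(a_L, u_L, w_L)`), its unbundled
form (`recP_eq_tsum_vec`), the chain weight as the printed product (`chainW_eq_prod`), and the Fin-vector summation
tools this needs and its user will need: peeling the last coordinate of a `tsum` / finite sum over `Fin (n+1) → β`
(`tsum_vec_succ`, `tsum_vec_succ'`, `sum_vec_succ`), splitting a vector of pairs (`tsum_vec_prod`), finite
components (`tsum_vec_fintype`), the product rule `Σ_{x : Fin n → β} ∏_i f_i(x_i) = ∏_i Σ_b f_i(b)`
(`tsum_vec_prod_eq_prod_tsum`), and the bond-sum collapse `Σ_{v : Fin n → G} (∏_i 𝟙{v_i = g_i}) X(v) = X(g)`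
(`tsum_vec_ite_eq`).  Nothing here is a cited hypothesis.
-/

noncomputable section

namespace Literature.Probability.FitznerVanDerHofstad2017.BlockSummation

open scoped ENNReal BigOperators

/-! ## A. Vector-indexed sums: peeling, splitting, products, indicators -/

section Vec

variable {β γ : Type*} {n : ℕ}

/-- `(Fin n → β) × β ≃ (Fin (n+1) → β)`: append the last coordinate (`Fin.snoc`). [folklore] -/
def vecSnocEquiv (n : ℕ) (β : Type*) : (Fin n → β) × β ≃ (Fin (n + 1) → β) where
  toFun c := Fin.snoc c.1 c.2
  invFun f := (Fin.init f, f (Fin.last n))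
  left_inv c := by
    obtain ⟨y, b⟩ := c
    simp only [Fin.init_snoc, Fin.snoc_last]
  right_inv f := by simp only [Fin.snoc_init_self]

/-- [folklore] -/
@[simp] theorem vecSnocEquiv_apply (c : (Fin n → β) × β) : vecSnocEquiv n β c = Fin.snoc c.1 c.2 := rfl

/-- **Peeling the last coordinate of a `tsum`** over `Fin (n+1) → β` (in `ℝ≥0∞`), last coordinate inside. [folklore] -/
theorem tsum_vec_succ (F : (Fin (n + 1) → β) → ℝ≥0∞) :
    ∑' x : Fin (n + 1) → β, F x = ∑' y : Fin n → β, ∑' b : β, F (Fin.snoc y b) := by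
  rw [← (vecSnocEquiv n β).tsum_eq F]
  exact ENNReal.tsum_prod (f := fun y b => F (Fin.snoc y b))

/-- The same with the last coordinate outside. [folklore] -/
theorem tsum_vec_succ' (F : (Fin (n + 1) → β) → ℝ≥0∞) :
    ∑' x : Fin (n + 1) → β, F x = ∑' b : β, ∑' y : Fin n → β, F (Fin.snoc y b) := by
  rw [tsum_vec_succ, ENNReal.tsum_comm]

/-- **Peeling the last coordinate of a finite sum** over `Fin (n+1) → K`. [folklore] -/
theorem sum_vec_succ {K : Type*} [Fintype K] {M : Type*} [AddCommMonoid M] (F : (Fin (n + 1) → K) → M) :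
    ∑ x : Fin (n + 1) → K, F x = ∑ y : Fin n → K, ∑ b : K, F (Fin.snoc y b) := by
  rw [← Fintype.sum_prod_type']
  exact (Fintype.sum_equiv (vecSnocEquiv n K) _ _ fun c => rfl).symm

/-- A `tsum` over the empty vector type picks the unique vector. [folklore] -/
theorem tsum_vec_zero (F : (Fin 0 → β) → ℝ≥0∞) : ∑' x : Fin 0 → β, F x = F Fin.elim0 := by
  rw [tsum_fintype, Fintype.sum_unique]
  exact congrArg F (Subsingleton.elim _ _)

/-- A finite sum over the empty vector type picks the unique vector. [folklore] -/
theorem sum_vec_zero {K : Type*} [Fintype K] {M : Type*} [AddCommMonoid M] (F : (Fin 0 → K) → M) :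
    ∑ x : Fin 0 → K, F x = F Fin.elim0 := by
  rw [Fintype.sum_unique]
  exact congrArg F (Subsingleton.elim _ _)

/-- A `tsum` over vectors with entries in a finite type is the finite sum. [folklore] -/
theorem tsum_vec_fintype {K : Type*} [Fintype K] (F : (Fin n → K) → ℝ≥0∞) :
    ∑' x : Fin n → K, F x = ∑ x : Fin n → K, F x := tsum_fintype F

/-- `(Fin n → β) × (Fin n → γ) ≃ (Fin n → β × γ)`: zip two vectors. [folklore] -/
def vecZipEquiv (n : ℕ) (β γ : Type*) : (Fin n → β) × (Fin n → γ) ≃ (Fin n → β × γ) where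
  toFun p i := (p.1 i, p.2 i)
  invFun f := (fun i => (f i).1, fun i => (f i).2)
  left_inv _ := rfl
  right_inv _ := rfl

/-- **Splitting a vector of pairs** into the pair of vectors: `Σ_{b : Fin n → β × γ} F(b) = Σ_u Σ_v F(i ↦ (u_i, v_i))`
(the pivotal bonds `b_i = (u_i, v_i)`). [folklore] -/
theorem tsum_vec_prod (F : (Fin n → β × γ) → ℝ≥0∞) :
    ∑' b : Fin n → β × γ, F b = ∑' u : Fin n → β, ∑' v : Fin n → γ, F (fun i => (u i, v i)) := by
  rw [← (vecZipEquiv n β γ).tsum_eq F]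
  exact ENNReal.tsum_prod (f := fun (u : Fin n → β) (v : Fin n → γ) => F (fun i => (u i, v i)))

/-- **Product rule**: `Σ_{x : Fin n → β} ∏_i f_i(x_i) = ∏_i Σ_b f_i(b)` in `[0,∞]`. [folklore] -/
theorem tsum_vec_prod_eq_prod_tsum : ∀ (n : ℕ) (f : Fin n → β → ℝ≥0∞),
    ∑' x : Fin n → β, ∏ i, f i (x i) = ∏ i, ∑' b, f i b
  | 0, f => by
    rw [tsum_vec_zero]
    simp only [Finset.univ_eq_empty, Finset.prod_empty]
  | n + 1, f => by
    rw [tsum_vec_succ, Fin.prod_univ_castSucc]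
    have h : ∀ (y : Fin n → β) (b : β),
        ∏ i, f i (Fin.snoc (α := fun _ => β) y b i) = (∏ i : Fin n, f i.castSucc (y i)) * f (Fin.last n) b := by
      intro y b
      rw [Fin.prod_univ_castSucc]
      simp only [Fin.snoc_castSucc, Fin.snoc_last]
    simp_rw [h, ENNReal.tsum_mul_left, ENNReal.tsum_mul_right]
    rw [tsum_vec_prod_eq_prod_tsum n (fun i => f i.castSucc)]

/-- A product of indicators is the indicator of the conjunction. [folklore] -/
theorem prod_ite_eq_ite_forall {α : Type*} [Fintype α] (p : α → Prop) [DecidablePred p] :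
    (∏ i, if p i then (1 : ℝ≥0∞) else 0) = if ∀ i, p i then 1 else 0 := by
  rw [Finset.prod_boole]
  simp only [Finset.mem_univ, true_implies]

/-- **Bond-sum collapse**: `Σ_{v : Fin n → G} (∏_i 𝟙{v_i = g_i}) X(v) = X(g)` — the sum over the far endpoints of the
pivotal bonds eats the indicators `𝟙{v_i = u_i + e_{κ_i}}`. [cite: FitznerVanDerHofstad2017, §6.1 after (6.4) "we replace the bond b₀ by (u,u+e_ι)" (arXiv:1506.07977v2 p. 58)] -/
theorem tsum_vec_ite_eq {G : Type*} [DecidableEq G] (g : Fin n → G) (X : (Fin n → G) → ℝ≥0∞) :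
    ∑' v : Fin n → G, (∏ i, if v i = g i then (1 : ℝ≥0∞) else 0) * X v = X g := by
  have h : ∀ v : Fin n → G, (∏ i, if v i = g i then (1 : ℝ≥0∞) else 0) * X v = if v = g then X v else 0 := by
    intro v
    rw [prod_ite_eq_ite_forall]
    by_cases hv : v = g
    · subst hv; simp
    · have hne : ¬ ∀ i, v i = g i := fun h' => hv (funext h')
      rw [if_neg hne, if_neg hv, zero_mul]
  simp_rw [h]
  rw [tsum_eq_single g fun v hv => if_neg hv, if_pos rfl]

end Vec

/-! ## B. The chain weight and the closed form of the recursion (6.49) -/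

section Chain

variable {G ι K : Type*}

/-- `Fin.snoc` at the first coordinate of a vector of length `≥ 2`. [folklore] -/
theorem snoc_apply_zero {α : Type*} {n : ℕ} (f : Fin (n + 1) → α) (x : α) :
    (Fin.snoc (α := fun _ => α) f x : Fin (n + 2) → α) 0 = f 0 := by
  rw [← Fin.castSucc_zero, Fin.snoc_castSucc]

/-- **The chain weight of `L` middle blocks**, level data bundled: for `δ_i = (u_i, w_i, κ_i, a_i)`, `i < L`, and the
exit data `(a_L, u_L, w_L)`,
`chainW S B L δ a_L u_L w_L = S(a_0,u_0,w_0) ∏_{i<L} B(κ_i,a_i,a_{i+1},u_i,w_i,w_{i+1},u_{i+1})`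
(the `B`-slots in the order of `recP` / (6.49): entry `(u_i,w_i)`, then `(w_{i+1},u_{i+1})`), defined by recursion
on `L` peeling the last block. [cite: FitznerVanDerHofstad2017, §6.2.1 (6.48)–(6.49) (arXiv:1506.07977v2 p. 65)] -/
def chainW (S : ι → G → G → ℝ≥0∞) (B : K → ι → ι → G → G → G → G → ℝ≥0∞) :
    (L : ℕ) → (Fin L → G × G × K × ι) → ι → G → G → ℝ≥0∞
  | 0, _, aL, uL, wL => S aL uL wL
  | L + 1, δ, aL, uL, wL =>
      chainW S B L (Fin.init δ) (δ (Fin.last L)).2.2.2 (δ (Fin.last L)).1 (δ (Fin.last L)).2.1 *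
        B (δ (Fin.last L)).2.2.1 (δ (Fin.last L)).2.2.2 aL (δ (Fin.last L)).1 (δ (Fin.last L)).2.1 wL uL

/-- [folklore] -/
theorem chainW_zero (S : ι → G → G → ℝ≥0∞) (B : K → ι → ι → G → G → G → G → ℝ≥0∞) (δ : Fin 0 → G × G × K × ι)
    (aL : ι) (uL wL : G) : chainW S B 0 δ aL uL wL = S aL uL wL := rfl

/-- Appending the last level. [cite: FitznerVanDerHofstad2017, §6.2.1 (6.49) (arXiv:1506.07977v2 p. 65)] -/
theorem chainW_succ_snoc (S : ι → G → G → ℝ≥0∞) (B : K → ι → ι → G → G → G → G → ℝ≥0∞) (L : ℕ)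
    (δ : Fin L → G × G × K × ι) (dL : G × G × K × ι) (aL : ι) (uL wL : G) :
    chainW S B (L + 1) (Fin.snoc δ dL) aL uL wL =
      chainW S B L δ dL.2.2.2 dL.1 dL.2.1 * B dL.2.2.1 dL.2.2.2 aL dL.1 dL.2.1 wL uL := by
  simp only [chainW, Fin.init_snoc, Fin.snoc_last]

/-- **The chain weight as the printed product** `S(a_0,u_0,w_0) ∏_{i<L} B(κ_i,a_i,a_{i+1},u_i,w_i,w_{i+1},u_{i+1})`, with
the completed vectors `(a_0,…,a_L) = Fin.snoc a a_L` etc. of the level data and the exit data.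
[cite: FitznerVanDerHofstad2017, §6.2.1 (6.48)–(6.49) (arXiv:1506.07977v2 p. 65)] -/
theorem chainW_eq_prod (S : ι → G → G → ℝ≥0∞) (B : K → ι → ι → G → G → G → G → ℝ≥0∞) :
    ∀ (L : ℕ) (u w : Fin L → G) (κ : Fin L → K) (a : Fin L → ι) (aL : ι) (uL wL : G),
      chainW S B L (fun i => (u i, w i, κ i, a i)) aL uL wL =
        S (Fin.snoc (α := fun _ => ι) a aL 0) (Fin.snoc (α := fun _ => G) u uL 0) (Fin.snoc (α := fun _ => G) w wL 0) *
          ∏ i : Fin L, B (κ i) (Fin.snoc (α := fun _ => ι) a aL i.castSucc) (Fin.snoc (α := fun _ => ι) a aL i.succ)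
            (Fin.snoc (α := fun _ => G) u uL i.castSucc) (Fin.snoc (α := fun _ => G) w wL i.castSucc)
            (Fin.snoc (α := fun _ => G) w wL i.succ) (Fin.snoc (α := fun _ => G) u uL i.succ)
  | 0, u, w, κ, a, aL, uL, wL => by
    have h0 : (0 : Fin 1) = Fin.last 0 := Subsingleton.elim _ _
    rw [chainW_zero, h0]
    simp only [Fin.snoc_last, Finset.univ_eq_empty, Finset.prod_empty, mul_one]
  | L + 1, u, w, κ, a, aL, uL, wL => by
    -- split the data into its initial part and its last entry
    have hδ : (fun i : Fin (L + 1) => (u i, w i, κ i, a i)) =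
        Fin.snoc (α := fun _ => G × G × K × ι)
          (fun i : Fin L => (Fin.init u i, Fin.init w i, Fin.init κ i, Fin.init a i))
          (u (Fin.last L), w (Fin.last L), κ (Fin.last L), a (Fin.last L)) := by
      funext i
      refine Fin.lastCases ?_ (fun j => ?_) i
      · simp only [Fin.snoc_last]
      · simp only [Fin.snoc_castSucc, Fin.init]
    rw [hδ, chainW_succ_snoc, chainW_eq_prod S B L, Fin.prod_univ_castSucc, mul_assoc]
    simp only [Fin.snoc_init_self]
    simp only [Fin.init, Fin.snoc_castSucc, Fin.snoc_last, Fin.succ_castSucc, Fin.succ_last, snoc_apply_zero]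

variable [Fintype ι] [Fintype K]

/-- The four sums of one level (`u, w ∈ G`, `κ ∈ K`, `a ∈ ι`) as one `tsum` over the bundled level datum
`(u, w, κ, a) : G × G × K × ι`. [folklore] -/
theorem tsum_levelData (f : G → G → K → ι → ℝ≥0∞) :
    ∑' d : G × G × K × ι, f d.1 d.2.1 d.2.2.1 d.2.2.2 = ∑' u, ∑' w, ∑ κ, ∑ a, f u w κ a := by
  calc ∑' d : G × G × K × ι, f d.1 d.2.1 d.2.2.1 d.2.2.2
      = ∑' u, ∑' r : G × K × ι, f u r.1 r.2.1 r.2.2 := ENNReal.tsum_prod (f := fun (u : G) (r : G × K × ι) => f u r.1 r.2.1 r.2.2)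
    _ = ∑' u, ∑' w, ∑' s : K × ι, f u w s.1 s.2 :=
        tsum_congr fun u => ENNReal.tsum_prod (f := fun (w : G) (s : K × ι) => f u w s.1 s.2)
    _ = ∑' u, ∑' w, ∑' κ, ∑' a, f u w κ a :=
        tsum_congr fun u => tsum_congr fun w => ENNReal.tsum_prod (f := fun (κ : K) (a : ι) => f u w κ a)
    _ = _ := by simp only [tsum_fintype]

/-- **(6.49) in closed form**: the recursively built left piece is the chain sum over all intermediate level data,
`P^{(L),a_L}(u_L,w_L) = Σ_{(u_i,w_i,κ_i,a_i)_{i<L}} S(a_0,u_0,w_0) ∏_{i<L} B(κ_i,a_i,a_{i+1},u_i,w_i,w_{i+1},u_{i+1})`.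
[cite: FitznerVanDerHofstad2017, §6.2.1 (6.48)–(6.49) and proof of Lemma 6.1 "induction on N" (arXiv:1506.07977v2 pp. 65–67)] -/
theorem recP_eq_tsum_chainW (S : ι → G → G → ℝ≥0∞) (B : K → ι → ι → G → G → G → G → ℝ≥0∞) :
    ∀ (L : ℕ) (aL : ι) (uL wL : G),
      recP S B L aL uL wL = ∑' δ : Fin L → G × G × K × ι, chainW S B L δ aL uL wL
  | 0, aL, uL, wL => by rw [tsum_vec_zero, recP_zero, chainW_zero]
  | L + 1, aL, uL, wL => by
    rw [recP_succ, tsum_vec_succ',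
      ← tsum_levelData (fun u' w' κ a => recP S B L a u' w' * B κ a aL u' w' wL uL)]
    refine tsum_congr fun dL => ?_
    rw [recP_eq_tsum_chainW S B L, ← ENNReal.tsum_mul_right]
    refine tsum_congr fun δ => ?_
    rw [chainW_succ_snoc]

/-- **(6.49) in closed form, unbundled**: the same with the four vectors of level data summed separately.
[cite: FitznerVanDerHofstad2017, §6.2.1 (6.48)–(6.49) (arXiv:1506.07977v2 p. 65)] -/
theorem recP_eq_tsum_vec (S : ι → G → G → ℝ≥0∞) (B : K → ι → ι → G → G → G → G → ℝ≥0∞) (L : ℕ) (aL : ι)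
    (uL wL : G) :
    recP S B L aL uL wL = ∑' u : Fin L → G, ∑' w : Fin L → G, ∑ κ : Fin L → K, ∑ a : Fin L → ι,
      chainW S B L (fun i => (u i, w i, κ i, a i)) aL uL wL := by
  rw [recP_eq_tsum_chainW, tsum_vec_prod]
  refine tsum_congr fun u => ?_
  rw [tsum_vec_prod]
  refine tsum_congr fun w => ?_
  rw [tsum_vec_prod, tsum_vec_fintype]
  refine Finset.sum_congr rfl fun κ _ => ?_
  exact tsum_vec_fintype _

/-- **(6.49) in closed form, as the printed product over the chain** (the shape in which per-class pointwise bounds of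
the `N ≥ 2` joint event are stated). [cite: FitznerVanDerHofstad2017, §6.2.1 (6.48)–(6.49) and Lemma 6.1 (arXiv:1506.07977v2 pp. 65–66)] -/
theorem recP_eq_tsum_prod (S : ι → G → G → ℝ≥0∞) (B : K → ι → ι → G → G → G → G → ℝ≥0∞) (L : ℕ) (aL : ι)
    (uL wL : G) :
    recP S B L aL uL wL = ∑' u : Fin L → G, ∑' w : Fin L → G, ∑ κ : Fin L → K, ∑ a : Fin L → ι,
      S (Fin.snoc (α := fun _ => ι) a aL 0) (Fin.snoc (α := fun _ => G) u uL 0) (Fin.snoc (α := fun _ => G) w wL 0) *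
        ∏ i : Fin L, B (κ i) (Fin.snoc (α := fun _ => ι) a aL i.castSucc) (Fin.snoc (α := fun _ => ι) a aL i.succ)
          (Fin.snoc (α := fun _ => G) u uL i.castSucc) (Fin.snoc (α := fun _ => G) w wL i.castSucc)
          (Fin.snoc (α := fun _ => G) w wL i.succ) (Fin.snoc (α := fun _ => G) u uL i.succ) := by
  rw [recP_eq_tsum_vec]
  simp only [chainW_eq_prod]

end Chain

end Literature.Probability.FitznerVanDerHofstad2017.BlockSummation
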